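import Literature.MathematicalPhysics.QuantumFieldTheory.Balaban1983to89.B8BlockConstantLiftStabilityRec
import Literature.MathematicalPhysics.QuantumFieldTheory.Balaban1983to89.B8BlockConstantLiftDataRec

/-!
# `Balaban1983to89.B8ExpMeanLogCrossTermRightConstRec` — [Balaban1985Averaging] (78)–(80): a transformation CONSTANT on the block tower (the junction's cell datum `X⁻¹`) multiplied on
# the RIGHT leaves the in-block OSCILLATION ROWS of the record averages unchanged — `‖(R̄₀ⁱ(f·g)(L·z))⁻¹·R̄₀ⁱ(f·g)(x) − 1‖ = ‖(R̄₀ⁱf(L·z))⁻¹·R̄₀ⁱf(x) − 1‖` under the cell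
# (the `hp` input of the cross-term tower bound for road (B′)'s `a = g_sr·X⁻¹` IS the one for `g_sr`)

statement-level skeleton of published theorems with citation tags; proofs where landed; nothing here is a claim about the Yang–Mills mass gap

CITATION HEADER (lean-in-tree rule).  Cell `pub-ymgap` (HUMAN RULING D-0062), the N05-REC → K0-road JUNCTION (width seat `pub-ymgap-dag-n07-w3` g13).  [3] = [Balaban1985Averaging] (78)–(80)
p. 30; [I] = [Balaban1987RG1] (0.3) p. 252.  `--kind proof --supports stmt-QuantumFields-20541` (K0⁷; count-neutral; no definition).  REUSED BY NAME: dag-n05-e's ✓p745465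
`B8BlockConstantLiftDataRec.rbar_one_mul_const_of_under` (exact right covariance), `B8Eq178AveragesRec.rbar_bgTZ_eq_uavgZ`, `B7Prop1Explicit.U1`, `B8Eq119TwistedAxialRec.UnderZ`,
`B8BlockConstantLiftStabilityRec.underZ_add`; SERVES (not imported) this seat's ✓p747787 `B8ExpMeanLogCrossTermGeomRec.rbar_one_mul_sub_mul_le_tower_local` (whose `hp` row this file rewrites).

WHY.  In road (B′) the first factor of the junction's product is `a = g_sr·X⁻¹` with `X⁻¹` CONSTANT on the tower under the cell (the pre-composition datum, ✓p748893); the cross-term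
bound wants the in-block oscillations `p_i` of `R̄₀ⁱa`.  By exact right covariance `R̄₀ⁱ(g_sr·X⁻¹) = R̄₀ⁱ(g_sr)·X⁻¹` at every site whose depth-`i` tower lies under the cell, and conjugation by
the `U1` unit `X⁻¹` is an isometry on `Y − 1`; so `p_i(a) = p_i(g_sr)` row by row — (σ2) of the junction's list reduces to the (167)-regularity of `g_sr` alone.

WHAT IS PROVED (sorry-free).  §1 `uavgZ_one_mul_const_of_under` (right covariance in `uavgZ L 1`), private `norm_mul_const_inv_mul_sub_one_eq` (`‖(A·c)⁻¹(B·c) − 1‖ = ‖A⁻¹B − 1‖`, `c ∈ U1`),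
★★ `osc_row_mul_const_eq` (the `hp` row of `f·g` at `(i, z, x)` under the cell equals the row of `f`, for `g ≡ c ∈ U1` on the cell's tower); §2 `uavgZ_one_const_mul_of_under`,
★★ `osc_row_const_mul_eq` (a block-constant LEFT factor cancels exactly: the junction's `g_sr = h̄·τ·h̄⁻¹`, `h̄` constant on the `j`-blocks ⇒ (σ2) = the (167)-regularity of `τ = w_s·w_r⁻¹`).
HONEST SCOPE.  Bookkeeping over landed identities; NO estimate; the (167)-regularity of `g_sr` ((σ2)) is NOT here; `HThm4Rec*` CONDITIONAL; N05 ∕ N07 NOT discharged; counts unmoved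
(typed 28∕28 · discharged 8∕28); one finite 𝕋⁴ programme at fixed ε — R4 closes the conditional finite-𝕋⁴ rung `BalabanLadder.UV` only; nothing continuum ∕ ℝ⁴ ∕ OS ∕ mass gap ∕ Clay.
No `def`, no `instance`, no `notation`, no `sorry`.
-/

set_option autoImplicit false

noncomputable section

open scoped BigOperators

namespace Literature.MathematicalPhysics.QuantumFieldTheory.Balaban1983to89.B8ExpMeanLogCrossTermRightConstRec

open B7Prop1Explicit hiding Site
open B7Prop1Explicit renaming Site → SiteZ
open B7SectEFLinearisationRec (zdBlockingZ bgTZ blockSitesZ)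
open B7SectCDGaugeAveragesRec (uavgZ)
open B8Eq119TwistedAxialRec (UnderZ underZ_one_block underZ_one_centre)
open B8Eq178AveragesRec (rbar_bgTZ_eq_uavgZ)
open B8BlockConstantLiftStabilityRec (underZ_add)
open B8BlockConstantLiftDataRec (rbar_one_mul_const_of_under rbar_one_const_mul_of_under)

variable {d : ℕ}

/-! ## §1  A block-constant `U1` factor on the RIGHT leaves the oscillation rows unchanged (the junction's `a = g_sr·X⁻¹`) -/

section RightConst

variable {𝔹 : Type*} [NormedRing 𝔹] [NormOneClass 𝔹] [NormedAlgebra ℂ 𝔹] [CompleteSpace 𝔹]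

omit [NormOneClass 𝔹] in
/-- (79)–(80) right covariance read in `uavgZ L 1`: if `g = c` on the tower under the level-`i` site `w`, then `R̄₀ⁱ(f·g)(w) = R̄₀ⁱf(w)·c` (n05-e's ✓p745465
`rbar_one_mul_const_of_under`, (78)-letters). [cite: Balaban1985Averaging, (78)–(80) p.30; Balaban1987RG1, (0.3) p.252] -/
theorem uavgZ_one_mul_const_of_under {L : ℕ} (hL : Odd L) (f g : SiteZ d → 𝔹ˣ) (c : 𝔹ˣ) (i : ℕ) (w : SiteZ d)
    (hg : ∀ x, UnderZ L i w x → g x = c) :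
    uavgZ L (1 : SiteZ d → Fin d → 𝔹ˣ) (f * g) i w = uavgZ L (1 : SiteZ d → Fin d → 𝔹ˣ) f i w * c := by
  apply Units.ext
  have h := rbar_one_mul_const_of_under hL f g c i w hg
  rw [rbar_bgTZ_eq_uavgZ, rbar_bgTZ_eq_uavgZ] at h
  simpa [Units.val_mul] using h

omit [NormedAlgebra ℂ 𝔹] [CompleteSpace 𝔹] in
/-- Conjugation by a `U1` unit is an isometry on `Y − 1`: `‖(A·c)⁻¹·(B·c) − 1‖ = ‖A⁻¹·B − 1‖` (`‖c‖, ‖c⁻¹‖ ≤ 1`) — private algebraic plumbing. [folklore] -/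
private theorem norm_mul_const_inv_mul_sub_one_eq (A B c : 𝔹ˣ) (hc : c ∈ U1 𝔹) :
    ‖(((A * c)⁻¹ * (B * c) : 𝔹ˣ) : 𝔹) - 1‖ = ‖((A⁻¹ * B : 𝔹ˣ) : 𝔹) - 1‖ := by
  obtain ⟨hc1, hc2⟩ := (B7Prop1Explicit.mem_U1).1 hc
  have hrew : (((A * c)⁻¹ * (B * c) : 𝔹ˣ) : 𝔹) - 1 = ((c⁻¹ : 𝔹ˣ) : 𝔹) * ((((A⁻¹ * B : 𝔹ˣ) : 𝔹) - 1)) * (c : 𝔹) := by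
    simp only [mul_inv_rev, Units.val_mul, mul_sub, sub_mul, mul_one]
    rw [mul_assoc, mul_assoc, ← mul_assoc ((A⁻¹ : 𝔹ˣ) : 𝔹), mul_assoc]
    simp
  apply le_antisymm
  · rw [hrew]
    calc ‖((c⁻¹ : 𝔹ˣ) : 𝔹) * (((A⁻¹ * B : 𝔹ˣ) : 𝔹) - 1) * (c : 𝔹)‖ ≤ ‖((c⁻¹ : 𝔹ˣ) : 𝔹)‖ * ‖((A⁻¹ * B : 𝔹ˣ) : 𝔹) - 1‖ * ‖(c : 𝔹)‖ := by
          exact (norm_mul_le _ _).trans (mul_le_mul_of_nonneg_right (norm_mul_le _ _) (norm_nonneg _))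
      _ ≤ 1 * ‖((A⁻¹ * B : 𝔹ˣ) : 𝔹) - 1‖ * 1 := by gcongr
      _ = ‖((A⁻¹ * B : 𝔹ˣ) : 𝔹) - 1‖ := by ring
  · have hrew' : ((A⁻¹ * B : 𝔹ˣ) : 𝔹) - 1 = (c : 𝔹) * ((((A * c)⁻¹ * (B * c) : 𝔹ˣ) : 𝔹) - 1) * ((c⁻¹ : 𝔹ˣ) : 𝔹) := by
      rw [hrew, ← mul_assoc, ← mul_assoc, Units.mul_inv, one_mul, mul_assoc, Units.mul_inv, mul_one]
    rw [hrew']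
    calc ‖(c : 𝔹) * ((((A * c)⁻¹ * (B * c) : 𝔹ˣ) : 𝔹) - 1) * ((c⁻¹ : 𝔹ˣ) : 𝔹)‖
          ≤ ‖(c : 𝔹)‖ * ‖(((A * c)⁻¹ * (B * c) : 𝔹ˣ) : 𝔹) - 1‖ * ‖((c⁻¹ : 𝔹ˣ) : 𝔹)‖ := by
          exact (norm_mul_le _ _).trans (mul_le_mul_of_nonneg_right (norm_mul_le _ _) (norm_nonneg _))
      _ ≤ 1 * ‖(((A * c)⁻¹ * (B * c) : 𝔹ˣ) : 𝔹) - 1‖ * 1 := by gcongr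
      _ = _ := by ring

/-- ★★ **A BLOCK-CONSTANT `U1` RIGHT FACTOR DOES NOT CHANGE THE OSCILLATION ROWS** (the junction's `a = g_sr·X⁻¹`, `X⁻¹` constant on the tower under the cell `y`): the `hp` hypothesis of
`rbar_one_mul_sub_mul_le_tower(_local)` for `f·g` IS the one for `f`, row by row: for `i < j`, `z` under `y` at depth `j − (i+1)` and `x ∈ B(z)`,
`‖(R̄₀ⁱ(f·g)(L·z))⁻¹·R̄₀ⁱ(f·g)(x) − 1‖ = ‖(R̄₀ⁱf(L·z))⁻¹·R̄₀ⁱf(x) − 1‖`. [cite: Balaban1985Averaging, (78)–(80) p.30; Balaban1987RG1, (0.3) p.252] -/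
theorem osc_row_mul_const_eq {L : ℕ} (hL : Odd L) (f g : SiteZ d → 𝔹ˣ) (c : 𝔹ˣ) (hc : c ∈ U1 𝔹) (j : ℕ) (y : SiteZ d)
    (hg : ∀ x, UnderZ L j y x → g x = c) {i : ℕ} (hij : i < j) {z : SiteZ d} (hz : UnderZ L (j - (i + 1)) y z) {x : SiteZ d} (hx : x ∈ blockSitesZ L z) :
    ‖((((uavgZ L (1 : SiteZ d → Fin d → 𝔹ˣ) (f * g) i ((L : ℤ) • z))⁻¹ * uavgZ L (1 : SiteZ d → Fin d → 𝔹ˣ) (f * g) i x : 𝔹ˣ)) : 𝔹) - 1‖ =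
      ‖((((uavgZ L (1 : SiteZ d → Fin d → 𝔹ˣ) f i ((L : ℤ) • z))⁻¹ * uavgZ L (1 : SiteZ d → Fin d → 𝔹ˣ) f i x : 𝔹ˣ)) : 𝔹) - 1‖ := by
  have hdepth : j - (i + 1) + 1 = j - i := by omega
  have hji : j - i + i = j := by omega
  -- the depth-`i` towers under the centre `L·z` and under the block point `x` lie in the tower under `y`
  have htower : ∀ w, UnderZ L (j - i) y w → ∀ x', UnderZ L i w x' → g x' = c := by
    intro w hw x' hx'
    have h := underZ_add hL hw hx'
    rw [hji] at h
    exact hg x' h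
  have hzc : UnderZ L (j - i) y ((L : ℤ) • z) := by
    have h := underZ_add hL hz (underZ_one_centre L z); rwa [hdepth] at h
  have hxc : UnderZ L (j - i) y x := by
    obtain ⟨r, rfl⟩ := B7SectEFLinearisationRec.mem_blockSitesZ.1 hx
    obtain ⟨s, hs⟩ := hL
    have h := underZ_add ⟨s, hs⟩ hz (underZ_one_block (by omega : L = 2 * s + 1) z r); rwa [hdepth] at h
  rw [uavgZ_one_mul_const_of_under hL f g c i _ (htower _ hzc), uavgZ_one_mul_const_of_under hL f g c i _ (htower _ hxc)]
  exact norm_mul_const_inv_mul_sub_one_eq _ _ c hc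



/-! ## §2  A block-constant factor on the LEFT: exact cancellation in the oscillation rows (the junction's `g_sr = Ad_{h̄}(τ)`, `h̄` constant on the `j`-blocks) -/

omit [NormOneClass 𝔹] in
/-- (79)–(80) left covariance read in `uavgZ L 1`: if `g = c` on the tower under the level-`i` site `w`, then `R̄₀ⁱ(g·f)(w) = c·R̄₀ⁱf(w)` (n05-e's ✓p745465
`rbar_one_const_mul_of_under`). [cite: Balaban1985Averaging, (78)–(80) p.30; Balaban1987RG1, (0.3) p.252] -/
theorem uavgZ_one_const_mul_of_under {L : ℕ} (hL : Odd L) (g f : SiteZ d → 𝔹ˣ) (c : 𝔹ˣ) (i : ℕ) (w : SiteZ d)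
    (hg : ∀ x, UnderZ L i w x → g x = c) :
    uavgZ L (1 : SiteZ d → Fin d → 𝔹ˣ) (g * f) i w = c * uavgZ L (1 : SiteZ d → Fin d → 𝔹ˣ) f i w := by
  apply Units.ext
  have h := rbar_one_const_mul_of_under hL g f c i w hg
  rw [rbar_bgTZ_eq_uavgZ, rbar_bgTZ_eq_uavgZ] at h
  simpa [Units.val_mul] using h

omit [NormOneClass 𝔹] in
/-- ★★ **A BLOCK-CONSTANT LEFT FACTOR CANCELS EXACTLY IN THE OSCILLATION ROWS** (`(c·A)⁻¹·(c·B) = A⁻¹·B`, no norm condition): for `g ≡ c` on the cell's tower, the `hp` row of `g·f` at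
`(i, z, x)` under the cell IS the row of `f`.  With §1: `p_i(h̄·τ·h̄⁻¹·X⁻¹) = p_i(τ)` under every cell for the junction's `g_sr·X⁻¹ = h̄·τ·h̄⁻¹·X⁻¹` (`h̄ = blockLift j h` constant on the
`j`-blocks, `X⁻¹` the cell datum), so (σ2) is the (167)-regularity of `τ = w_s·w_r⁻¹` alone. [cite: Balaban1985Averaging, (78)–(80) p.30; Balaban1987RG1, (0.3) p.252] -/
theorem osc_row_const_mul_eq {L : ℕ} (hL : Odd L) (g f : SiteZ d → 𝔹ˣ) (c : 𝔹ˣ) (j : ℕ) (y : SiteZ d)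
    (hg : ∀ x, UnderZ L j y x → g x = c) {i : ℕ} (hij : i < j) {z : SiteZ d} (hz : UnderZ L (j - (i + 1)) y z) {x : SiteZ d} (hx : x ∈ blockSitesZ L z) :
    ((uavgZ L (1 : SiteZ d → Fin d → 𝔹ˣ) (g * f) i ((L : ℤ) • z))⁻¹ * uavgZ L (1 : SiteZ d → Fin d → 𝔹ˣ) (g * f) i x : 𝔹ˣ) =
      (uavgZ L (1 : SiteZ d → Fin d → 𝔹ˣ) f i ((L : ℤ) • z))⁻¹ * uavgZ L (1 : SiteZ d → Fin d → 𝔹ˣ) f i x := by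
  have hdepth : j - (i + 1) + 1 = j - i := by omega
  have hji : j - i + i = j := by omega
  have htower : ∀ w, UnderZ L (j - i) y w → ∀ x', UnderZ L i w x' → g x' = c := by
    intro w hw x' hx'
    have h := underZ_add hL hw hx'
    rw [hji] at h
    exact hg x' h
  have hzc : UnderZ L (j - i) y ((L : ℤ) • z) := by
    have h := underZ_add hL hz (underZ_one_centre L z); rwa [hdepth] at h
  have hxc : UnderZ L (j - i) y x := by
    obtain ⟨r, rfl⟩ := B7SectEFLinearisationRec.mem_blockSitesZ.1 hx
    obtain ⟨s, hs⟩ := hL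
    have h := underZ_add ⟨s, hs⟩ hz (underZ_one_block (by omega : L = 2 * s + 1) z r); rwa [hdepth] at h
  rw [uavgZ_one_const_mul_of_under hL g f c i _ (htower _ hzc), uavgZ_one_const_mul_of_under hL g f c i _ (htower _ hxc),
    mul_inv_rev, mul_assoc, inv_mul_cancel_left]

end RightConst

end Literature.MathematicalPhysics.QuantumFieldTheory.Balaban1983to89.B8ExpMeanLogCrossTermRightConstRec

end
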